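import Literature.Analysis.Approximation.EhlichZeller
import Literature.Analysis.Approximation.ExtrapolationLebesgueFunction
import HarnessLib

/-!
# Paturi's degree inequality for polynomials bounded at the integer points — the two regimes
# used by Aaronson–Shi and Kutin (centre: `deg = Ω(L)`; end: `deg = Ω(√L)`)

**The printed statement.** R. Paturi, *On the degree of polynomials that approximate symmetric
Boolean functions*, STOC 1992, Thm 4 (p. 471): "Let `f` be a non-constant symmetric boolean
function on `x₁, …, x_n`. Then any multilinear polynomial that approximates `f` within error
`1/3` has degree `Ω(√(n(n − Γ(f))))`"; in the form in which it is quoted and used by Aaronson–Shi,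
J. ACM 51 (2004), Thm 3.4 ("Paturi") and Kutin, Theory of Computing 1 (2005), Thm 2: "Let
`q(α) ∈ ℝ[α]` be a polynomial of degree `d`, `a < b` integers and `ξ ∈ [a, b]` real. If
(1) `|q(i)| ≤ c₁` for all integers `i ∈ [a, b]`, and (2) `|q(⌊ξ⌋) − q(ξ)| ≥ c₂` for some constant
`c₂ > 0`, then `d = Ω(√((ξ − a + 1)(b − ξ + 1)))`. … Note that, if the conditions of the theorem
are met for any `ξ`, we have `d = Ω(√(b − a))`. If they are met for some `ξ ≈ (a + b)/2`, then
`d = Ω(b − a)`" (Kutin p. 31, read on `lit read arxiv:quant-ph/0304162` p0004 L54–70).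

**What is typed** (namespace `Literature.Analysis.Approximation`), with explicit constants:
* the END regime `d = Ω(√(b − a))` (`paturi_end`, `paturi_end_shift`): `b₁ ≤ q(i) ≤ b₂` on the
  integers of `[a, a + L]` and a jump `|q(i₀ + 1) − q(i₀)| ≥ c` between two consecutive such
  integers give `c · L ≤ deg(q)² · (c + b₂ − b₁)` — this is the tree's Ehlich–Zeller /
  Rivlin–Cheney theorem (`ehlichZeller_rivlinCheney`, Beals et al. Thm 4.12) after a mean value
  step, recorded here in Paturi's "jump" form;
* the CENTRE regime `d = Ω(b − a)` (`paturi_central`): `|q(i)| ≤ c` on the integers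
  `0, …, L` and `|q(ξ)| ≥ 2c` at a real point `ξ` of the middle half `[L/4, 3L/4]` give
  `L ≤ 91 · deg(q)`;
* on the way, the a-priori bound behind the centre regime (Paturi's §3.1 "Corollary 1", p. 471:
  "Let `p(x)` be a polynomial of degree at most `d < n` and `|p(i)| < c` for integers
  `i = 0, …, n`, then … `|p(x)| ≤ c·2^{O(d)}` … for all `x` in the closed interval `[0, n]`" — the
  printed constant is garbled in the held scan; any `2^{O(d)}` serves the proof), here as
  `abs_eval_le_mul_six_pow_of_forall_nat` with the constant `6^d` (Lagrange interpolation at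
  `d + 1` consecutive integers; the Lebesgue function of consecutive integer nodes is
  `≤ 2^d d^d / d! ≤ (2e)^d ≤ 6^d` inside their span, `lebesgueFunction_consecutive_le`, via the
  tree's `ExtrapolationLebesgueFunction.abs_eval_le_mul_lebesgueFunction`).

NOT typed: the general mixed form `Ω(√((ξ − a + 1)(b − ξ + 1)))` for `ξ` near (but not at) an
end — Paturi's Case 2 (p. 472–473), which passes to trigonometric polynomials `p(cos θ)`; the two
regimes above are exactly what the collision lower bound (Kutin §3) consumes.

**The printed proof of the centre regime** (Paturi §3, p. 471: "a successful application of
these inequalities requires that the norm of `p` in the interval `[−1, 1]` be small. But, our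
construction only guarantees that `|p(2i/n − 1)| ≤ 4/3` for `i = 0, …, n` and it is in general
possible for `p` to have a norm of `2^d` in the interval … We avoid this problem by multiplying
the polynomial with a suitable … polynomial to control the norm of the polynomial and at the same
time maintaining the high derivative as does the original polynomial. We then apply
Bernstein–Markov inequalities to obtain the desired lower bound"; Case 1, p. 472: "`q̃(x) =
q(x)(1 − x²)^m` where `m = 6⌈d/c₁²⌉` … for `x ∈ [−1, −c₁] ∪ [c₁, 1]` we have `|q̃(x)| ≤
|q(x)| e^{−c₁² m} ≤ 1` … even if `q̃` assumes high values at other points in the interval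
`[−c₁, c₁]`, we can conclude that, for some `x ∈ [−c₁, c₁]`, `q̃'(x) ≥ n‖q̃‖/8`. Hence, by applying
Bernstein–Markov inequality for `q̃`, we obtain the degree of `q̃` is `Ω(n)`") is followed here
with `c₁ = 1/2`: rescale the window `[ξ − R, ξ + R] ⊆ [0, L]`, `R = min(ξ, L − ξ) ≥ L/4`, to
`[−1, 1]` (`g(u) = q(ξ + R u)`, `|g| ≤ c·6^d` by the a-priori bound); damp,
`q̃ = g · (1 − u²)^{7d}` (degree `≤ 15 d`; `6^d (3/4)^{7d} ≤ 1`, so `|q̃| ≤ c` for `|u| ≥ 1/2`);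
the maximum `M ≥ |q̃(0)| = |q(ξ)| ≥ 2c` of `|q̃|` on `[−1, 1]` is attained at some `|u*| < 1/2`;
the nearest grid point `u_i = (i − ξ)/R` (`i` the integer nearest to `ξ + R u*`) has
`|q̃(u_i)| ≤ |q(i)| ≤ c ≤ M/2` and `|u* − u_i| ≤ 1/(2R)`, so `|q̃'(ζ)| ≥ M R` at some `|ζ| ≤ 3/4`
(mean value theorem); Bernstein's inequality (`bernstein_inequality`, tree file
`MarkovInequality.lean`) `|q̃'(ζ)| √(1 − ζ²) ≤ 15 d · M` then gives `R √7 / 4 ≤ 15 d`, i.e.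
`L ≤ 240 d/√7 < 91 d`.

## References

* R. Paturi, *On the degree of polynomials that approximate symmetric Boolean functions
  (preliminary version)*, Proc. 24th STOC (1992) 468–474, §3 (§3.1 Fact 1 / Cor. 1, §3.2 Facts 3–4 (Bernstein–Markov), Thm 4
  and Case 1 of its proof), doi:10.1145/129712.129758 (held: `lit read doi:10.1145/129712.129758`,
  pp. 471–472) [Paturi1992].
* S. Kutin, *Quantum lower bound for the collision problem with small range*, Theory of
  Computing 1 (2005) 29–36, Thm 2 and the remark after it (arXiv:quant-ph/0304162 p0004)
  [Kutin2005].
* S. Aaronson, Y. Shi, *Quantum lower bounds for the collision and the element distinctness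
  problems*, J. ACM 51 (2004) 595–605, Thm 3.2–3.4 (p0006–p0007) [AaronsonShi2004].
* R. Beals, H. Buhrman, R. Cleve, M. Mosca, R. de Wolf, *Quantum lower bounds by polynomials*,
  J. ACM 48 (2001), Thm 4.12 (the end regime) [BealsEtAl2001].
-/

open Polynomial Real Finset Lagrange
open Literature.Analysis.Approximation.ExtrapolationLebesgueFunction

namespace Literature.Analysis.Approximation

/-! ### The Lebesgue function of consecutive integer nodes -/

/-- `∏_{j < k} |k − j| = k!`. [folklore] -/
private theorem prod_range_abs_sub_eq_factorial (k : ℕ) :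
    ∏ j ∈ range k, |(k : ℝ) - j| = k.factorial := by
  have h : ∀ j ∈ range k, |(k : ℝ) - j| = ((k - 1 - j : ℕ) : ℝ) + 1 := by
    intro j hj
    rw [mem_range] at hj
    rw [abs_of_nonneg (sub_nonneg.mpr (by exact_mod_cast hj.le))]
    have : j + 1 ≤ k := hj
    push_cast [Nat.sub_sub, Nat.cast_sub (by omega : 1 + j ≤ k)]
    ring
  rw [prod_congr rfl h, prod_range_reflect (fun j => ((j : ℕ) : ℝ) + 1) k,
    ← Finset.prod_range_add_one_eq_factorial k]
  push_cast
  rfl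

/-- `∏_{j ≤ d, j ≠ k} |k − j| = k! (d − k)!` for `k ≤ d` (the nodal weights of consecutive
integer nodes). [folklore] -/
private theorem prod_erase_abs_sub_eq (d k : ℕ) (hk : k ≤ d) :
    ∏ j ∈ (range (d + 1)).erase k, |(k : ℝ) - j| = k.factorial * (d - k).factorial := by
  obtain ⟨e, rfl⟩ := Nat.exists_eq_add_of_le hk
  induction e with
  | zero =>
    rw [add_zero, range_add_one, erase_insert (by simp), prod_range_abs_sub_eq_factorial]
    simp
  | succ e ih =>
    have hmem : k ∈ range (k + e + 1) := by simp
    have hne : k + e + 1 ≠ k := by omega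
    rw [show k + (e + 1) + 1 = (k + e + 1) + 1 by ring, range_add_one,
      erase_insert_of_ne hne, prod_insert (by simp), ih (by omega)]
    rw [show k + (e + 1) - k = (e + 1) by omega, show k + e - k = e by omega,
      Nat.factorial_succ, abs_sub_comm, abs_of_nonneg (by push_cast; linarith)]
    push_cast
    ring

/-- **A-priori growth between consecutive integer nodes** (Paturi 1992, §3.1 Fact 1 / Cor. 1
type bound: a polynomial of degree `≤ d` bounded at `d + 1` consecutive integers grows at most
exponentially in `d` between them): the Lebesgue function `Σ_k |ℓ_k(t)|` of the nodes
`a, a + 1, …, a + d` is at most `6^d` on `[a, a + d]` (indeed `≤ 2^d d^d / d! ≤ (2e)^d`: each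
`|ℓ_k(t)| ≤ d^d / (k! (d − k)!)`). [cite: Paturi1992, §3.1 Fact 1 and Corollary 1 (p. 471)] -/
theorem lebesgueFunction_consecutive_le (a : ℝ) (d : ℕ) {t : ℝ} (ht : t ∈ Set.Icc a (a + d)) :
    lebesgueFunction (range (d + 1)) (fun j : ℕ => a + j) t ≤ (6 : ℝ) ^ d := by
  classical
  -- each fundamental polynomial
  have hterm : ∀ k ∈ range (d + 1),
      |(Lagrange.basis (range (d + 1)) (fun j : ℕ => a + j) k).eval t| ≤
        (d : ℝ) ^ d / (k.factorial * (d - k).factorial) := by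
    intro k hk
    have hkd : k ≤ d := by simpa [Nat.lt_succ_iff] using hk
    rw [eval_basis_eq_nodalWeight_mul_prod, abs_mul, nodalWeight, abs_prod, abs_prod]
    have hden : ∏ j ∈ (range (d + 1)).erase k, |((a + k : ℝ) - (a + j))⁻¹| =
        (k.factorial * (d - k).factorial : ℝ)⁻¹ := by
      rw [← prod_erase_abs_sub_eq d k hkd, ← prod_inv_distrib]
      refine prod_congr rfl fun j _ => ?_
      rw [abs_inv]
      congr 1
      ring_nf
    rw [hden, div_eq_inv_mul]
    have hfac : (0 : ℝ) < k.factorial * (d - k).factorial := by positivity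
    refine mul_le_mul_of_nonneg_left ?_ (inv_nonneg.mpr hfac.le)
    have hcard : ((range (d + 1)).erase k).card = d := by
      rw [card_erase_of_mem hk, card_range]; rfl
    calc ∏ j ∈ (range (d + 1)).erase k, |t - (a + j)|
        ≤ ∏ _j ∈ (range (d + 1)).erase k, (d : ℝ) := by
          refine prod_le_prod (fun j _ => abs_nonneg _) fun j hj => ?_
          have hjd : (j : ℝ) ≤ d := by
            have := mem_range.mp (mem_of_mem_erase hj)
            exact_mod_cast Nat.lt_succ_iff.mp this
          have hj0 : (0 : ℝ) ≤ j := Nat.cast_nonneg _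
          rw [abs_le]
          constructor <;> linarith [ht.1, ht.2]
      _ = (d : ℝ) ^ d := by rw [prod_const, hcard]
  -- sum over `k`
  have hsum : ∑ k ∈ range (d + 1), (d : ℝ) ^ d / (k.factorial * (d - k).factorial) =
      (d : ℝ) ^ d / d.factorial * 2 ^ d := by
    have h2 : ((2 : ℕ) ^ d : ℕ) = ∑ k ∈ range (d + 1), d.choose k := (Nat.sum_range_choose d).symm
    have : (2 : ℝ) ^ d = ∑ k ∈ range (d + 1), (d.choose k : ℝ) := by exact_mod_cast h2
    rw [this, mul_sum]
    refine sum_congr rfl fun k hk => ?_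
    have hkd : k ≤ d := by simpa [Nat.lt_succ_iff] using hk
    have hch : (d.choose k : ℝ) * (k.factorial * (d - k).factorial) = d.factorial := by
      have := Nat.choose_mul_factorial_mul_factorial hkd
      rw [← mul_assoc]; exact_mod_cast this
    have hfac : (0 : ℝ) < k.factorial * (d - k).factorial := by positivity
    have hdf : (0 : ℝ) < d.factorial := by positivity
    field_simp
    rw [← hch]
    ring
  -- `d^d / d! ≤ e^d ≤ 3^d`
  have hexp : (d : ℝ) ^ d / d.factorial ≤ 3 ^ d := by
    have h1 : (d : ℝ) ^ d / d.factorial ≤ Real.exp d :=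
      Real.pow_div_factorial_le_exp (d : ℝ) (Nat.cast_nonneg d) d
    have h2 : Real.exp d = Real.exp 1 ^ d := by rw [← Real.exp_one_pow]
    have h3 : Real.exp 1 ≤ 3 := by linarith [Real.exp_one_lt_d9]
    exact h1.trans (h2 ▸ pow_le_pow_left₀ (Real.exp_pos 1).le h3 d)
  calc lebesgueFunction (range (d + 1)) (fun j : ℕ => a + j) t
      ≤ ∑ k ∈ range (d + 1), (d : ℝ) ^ d / (k.factorial * (d - k).factorial) :=
        sum_le_sum hterm
    _ = (d : ℝ) ^ d / d.factorial * 2 ^ d := hsum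
    _ ≤ 3 ^ d * 2 ^ d := mul_le_mul_of_nonneg_right hexp (by positivity)
    _ = 6 ^ d := by rw [← mul_pow]; norm_num

/-- **Paturi's a-priori bound** (§3.1 Cor. 1: "Let `p(x)` be a polynomial of degree at most
`d < n` and `|p(i)| ≤ c` for integers `i = 0, …, n`, then `|p(x)| ≤ c·2^{O(d)}` for all `x` in
the closed interval `[0, n]`"), with the constant `6^d`: if `deg p ≤ d ≤ L` and `|p(i)| ≤ c` at
the integers `0 ≤ i ≤ L`, then `|p(x)| ≤ c · 6^d` on `[0, L]`.
[cite: Paturi1992, §3.1 Corollary 1 (p. 471)] -/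
theorem abs_eval_le_mul_six_pow_of_forall_nat {p : ℝ[X]} {d L : ℕ} {c : ℝ} (hp : p.natDegree ≤ d)
    (hdL : d ≤ L) (hint : ∀ i : ℕ, i ≤ L → |p.eval (i : ℝ)| ≤ c) {x : ℝ}
    (hx : x ∈ Set.Icc (0 : ℝ) L) : |p.eval x| ≤ c * 6 ^ d := by
  classical
  rcases Nat.eq_zero_or_pos d with rfl | hd
  · -- constant polynomial
    rw [pow_zero, mul_one]
    have h0 : |p.eval 0| ≤ c := by simpa using hint 0 (Nat.zero_le _)
    have hc : p = C (p.eval 0) := by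
      rw [eq_C_of_natDegree_eq_zero (Nat.le_zero.mp hp)]; simp
    rw [hc, eval_C]
    exact h0
  -- the window of `d + 1` consecutive integers `a, …, a + d ∋ x` inside `[0, L]`
  set a : ℕ := min ⌊x⌋₊ (L - d) with ha
  have haL : a + d ≤ L := by
    have : a ≤ L - d := min_le_right _ _
    omega
  have hax : (a : ℝ) ≤ x := by
    have h1 : (a : ℝ) ≤ ⌊x⌋₊ := by exact_mod_cast min_le_left _ _
    exact h1.trans (Nat.floor_le hx.1)
  have hxa : x ≤ (a : ℝ) + d := by
    rcases le_total ⌊x⌋₊ (L - d) with h | h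
    · have : a = ⌊x⌋₊ := min_eq_left h
      rw [this]
      have h1 : x < ⌊x⌋₊ + 1 := Nat.lt_floor_add_one x
      have h2 : (1 : ℝ) ≤ d := by exact_mod_cast hd
      linarith
    · have : a = L - d := min_eq_right h
      rw [this, Nat.cast_sub hdL]
      linarith [hx.2]
  -- Lagrange interpolation at the window
  have hinj : Set.InjOn (fun j : ℕ => (a : ℝ) + j) (range (d + 1) : Finset ℕ) := by
    intro i _ j _ hij
    have : (i : ℝ) = j := by simpa using hij
    exact_mod_cast this
  have hdeg : p.degree < #(range (d + 1)) := by
    rw [card_range]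
    exact (degree_le_of_natDegree_le hp).trans_lt (by exact_mod_cast Nat.lt_succ_self d)
  have hnodes : ∀ j ∈ range (d + 1), |p.eval ((a : ℝ) + j)| ≤ c := by
    intro j hj
    have hj' : j ≤ d := Nat.lt_succ_iff.mp (mem_range.mp hj)
    have := hint (a + j) (by omega)
    simpa [Nat.cast_add] using this
  have hleb := abs_eval_le_mul_lebesgueFunction (range (d + 1)) (fun j : ℕ => (a : ℝ) + j) hinj
    hdeg hnodes x
  have hc0 : 0 ≤ c := (abs_nonneg _).trans (hint 0 (Nat.zero_le _))
  exact hleb.trans (mul_le_mul_of_nonneg_left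
    (lebesgueFunction_consecutive_le (a : ℝ) d ⟨hax, hxa⟩) hc0)

/-! ### The end regime: a jump between consecutive integers (Ehlich–Zeller in Paturi's form) -/

/-- **Paturi's inequality, end regime** (`d = Ω(√(b − a))`: Kutin Thm 2 "if the conditions of
the theorem are met for any `ξ`, we have `d = Ω(√(b − a))`"; = Beals et al. Thm 4.12 after a mean
value step): if `b₁ ≤ q(i) ≤ b₂` at the integers `0 ≤ i ≤ L` and `|q(i₀ + 1) − q(i₀)| ≥ c > 0`
for some `i₀ < L`, then `c · L ≤ deg(q)² · (c + b₂ − b₁)`.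
[cite: Paturi1992, Thm 4 (p. 471)] [cite: Kutin2005, Thm 2] [cite: BealsEtAl2001, Thm 4.12] -/
theorem paturi_end {q : ℝ[X]} {L : ℕ} {b₁ b₂ c : ℝ} (hc : 0 < c)
    (hb : ∀ i : ℕ, i ≤ L → b₁ ≤ q.eval (i : ℝ) ∧ q.eval (i : ℝ) ≤ b₂) {i₀ : ℕ} (hi₀ : i₀ < L)
    (hjump : c ≤ |q.eval ((i₀ : ℝ) + 1) - q.eval (i₀ : ℝ)|) :
    c * L ≤ (q.natDegree : ℝ) ^ 2 * (c + b₂ - b₁) := by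
  -- mean value theorem on `[i₀, i₀ + 1]`
  obtain ⟨ξ, hξ, hξd⟩ := exists_deriv_eq_slope (fun x => q.eval x)
    (by linarith : (i₀ : ℝ) < i₀ + 1) q.differentiable.continuous.continuousOn
    (fun x _ => q.differentiableAt.differentiableWithinAt)
  rw [Polynomial.deriv] at hξd
  have hder : c ≤ |(derivative q).eval ξ| := by
    rw [hξd, show (i₀ : ℝ) + 1 - i₀ = 1 by ring, div_one]
    exact hjump
  have hξI : ξ ∈ Set.Icc (0 : ℝ) L := by
    refine ⟨?_, ?_⟩
    · linarith [hξ.1, (Nat.cast_nonneg i₀ : (0 : ℝ) ≤ i₀)]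
    · have : (i₀ : ℝ) + 1 ≤ L := by exact_mod_cast hi₀
      linarith [hξ.2]
  exact ehlichZeller_rivlinCheney hc hb ⟨ξ, hξI, hder⟩

/-- The end regime on a shifted integer interval `a, a + 1, …, a + L` (any real shift `a`):
`b₁ ≤ q(a + i) ≤ b₂` for `0 ≤ i ≤ L` and `|q(a + i₀ + 1) − q(a + i₀)| ≥ c > 0`, `i₀ < L`, give
`c · L ≤ deg(q)² · (c + b₂ − b₁)`. [cite: Paturi1992, Thm 4 (p. 471)] [cite: Kutin2005, Thm 2] -/
theorem paturi_end_shift {q : ℝ[X]} (a : ℝ) {L : ℕ} {b₁ b₂ c : ℝ} (hc : 0 < c)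
    (hb : ∀ i : ℕ, i ≤ L → b₁ ≤ q.eval (a + i) ∧ q.eval (a + i) ≤ b₂) {i₀ : ℕ} (hi₀ : i₀ < L)
    (hjump : c ≤ |q.eval (a + i₀ + 1) - q.eval (a + i₀)|) :
    c * L ≤ (q.natDegree : ℝ) ^ 2 * (c + b₂ - b₁) := by
  set q' := q.comp (X + C a) with hq'
  have hev : ∀ x : ℝ, q'.eval x = q.eval (a + x) := fun x => by
    rw [hq', eval_comp]; simp [add_comm]
  have hb' : ∀ i : ℕ, i ≤ L → b₁ ≤ q'.eval (i : ℝ) ∧ q'.eval (i : ℝ) ≤ b₂ := fun i hi => by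
    rw [hev]; exact hb i hi
  have hjump' : c ≤ |q'.eval ((i₀ : ℝ) + 1) - q'.eval (i₀ : ℝ)| := by
    rw [hev, hev, ← add_assoc]; exact hjump
  have h := paturi_end hc hb' hi₀ hjump'
  have hdeg : q'.natDegree ≤ q.natDegree := by
    calc q'.natDegree ≤ q.natDegree * (X + C a).natDegree := natDegree_comp_le
      _ ≤ q.natDegree * 1 := by
          gcongr
          exact (natDegree_add_le _ _).trans (max_le natDegree_X_le (by simp))
      _ = q.natDegree := mul_one _
  have hB : b₁ ≤ b₂ := (hb 0 (Nat.zero_le L)).1.trans (hb 0 (Nat.zero_le L)).2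
  have hpos : 0 ≤ c + b₂ - b₁ := by linarith
  calc c * L ≤ (q'.natDegree : ℝ) ^ 2 * (c + b₂ - b₁) := h
    _ ≤ (q.natDegree : ℝ) ^ 2 * (c + b₂ - b₁) := by
        gcongr

/-- Mean value step: if `K · (b − a) ≤ |f(b) − f(a)|` on `a < b` then `|f'(ζ)| ≥ K` somewhere in
`(a, b)`. [folklore] -/
private theorem exists_abs_derivative_ge {f : ℝ[X]} {a b : ℝ} (hab : a < b) {K : ℝ}
    (hK : K * |b - a| ≤ |f.eval b - f.eval a|) :
    ∃ ζ ∈ Set.Ioo a b, K ≤ |(derivative f).eval ζ| := by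
  obtain ⟨ζ, hζ, hζd⟩ := exists_deriv_eq_slope (fun x => f.eval x) hab
    f.differentiable.continuous.continuousOn (fun x _ => f.differentiableAt.differentiableWithinAt)
  rw [Polynomial.deriv] at hζd
  refine ⟨ζ, hζ, ?_⟩
  have hba : 0 < |b - a| := abs_pos.mpr (sub_ne_zero.mpr hab.ne')
  rw [hζd, abs_div, le_div_iff₀ hba]
  exact hK

/-! ### The centre regime: growth at a point of the middle half -/

/-- The closing arithmetic of the centre regime: `L/4 ≤ R`, `R √7/4 ≤ 15 d` and `91 d < L` are
incompatible (`240/√7 < 91`). [folklore] -/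
private theorem paturi_central_arith {L d R : ℝ} (hR4 : L / 4 ≤ R)
    (hfin : R * (Real.sqrt 7 / 4) ≤ 15 * d) (hcon : 91 * d < L) (hd : 1 ≤ d) : False := by
  have h77 : (240 : ℝ) / 91 < Real.sqrt 7 := by
    rw [show (240 : ℝ) / 91 = √((240 / 91) ^ 2) by rw [Real.sqrt_sq (by norm_num)]]
    exact Real.sqrt_lt_sqrt (by norm_num) (by norm_num)
  have hL : 0 < L := by linarith
  have h1 : L * Real.sqrt 7 ≤ 240 * d := by nlinarith [hR4, hfin, Real.sqrt_nonneg 7]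
  have h2 : L * (240 / 91) < L * Real.sqrt 7 := mul_lt_mul_of_pos_left h77 hL
  nlinarith
set_option maxHeartbeats 400000 in -- buildfix (bf3-g30): 160k/180k FAIL, 200k PASS at accept time; line-neutral budget line
/-- **Paturi's inequality, centre regime** (`d = Ω(b − a)`: Kutin Thm 2 "If they are met for
some `ξ ≈ (a + b)/2`, then `d = Ω(b − a)`"; Case 1 of the proof of Paturi's Thm 4), explicit
form: if `deg q ≤ d`, `d ≥ 1`, `|q(i)| ≤ c` at the integers `0 ≤ i ≤ L`, and `|q(ξ)| ≥ 2c`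
(`c > 0`) at some real `ξ` with `L/4 ≤ ξ ≤ 3L/4`, then `L ≤ 91 · d`.
[cite: Paturi1992, Thm 4, proof Case 1 (p. 472)] [cite: Kutin2005, Thm 2]
[cite: AaronsonShi2004, Thm 3.4] -/
theorem paturi_central {q : ℝ[X]} {d L : ℕ} {c ξ : ℝ} (hc : 0 < c) (hq : q.natDegree ≤ d)
    (hd : 1 ≤ d) (hint : ∀ i : ℕ, i ≤ L → |q.eval (i : ℝ)| ≤ c) (hξ₁ : (L : ℝ) ≤ 4 * ξ)
    (hξ₂ : 4 * ξ ≤ 3 * L) (hξ : 2 * c ≤ |q.eval ξ|) : (L : ℝ) ≤ 91 * d := by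
  classical
  by_contra hcon
  push Not at hcon
  have hd' : (1 : ℝ) ≤ d := by exact_mod_cast hd
  have hL : (91 : ℝ) < L := by nlinarith
  have hdL : d ≤ L := by
    have : (d : ℝ) ≤ L := by linarith
    exact_mod_cast this
  -- the window `[ξ - R, ξ + R] ⊆ [0, L]`
  set R := min ξ (L - ξ) with hR
  have hRξ : R ≤ ξ := min_le_left _ _
  have hRL : R ≤ L - ξ := min_le_right _ _
  have hR4 : (L : ℝ) / 4 ≤ R := le_min (by linarith) (by linarith)
  have hR2 : (2 : ℝ) ≤ R := by linarith
  have hRpos : 0 < R := by linarith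
  have hwin : ∀ u ∈ Set.Icc (-1 : ℝ) 1, ξ + R * u ∈ Set.Icc (0 : ℝ) L := by
    intro u hu
    constructor <;> nlinarith [hu.1, hu.2]
  -- rescale: `g(u) = q(ξ + R u)`
  set g := q.comp (C R * X + C ξ) with hg
  have hgev : ∀ u : ℝ, g.eval u = q.eval (ξ + R * u) := fun u => by
    rw [hg, eval_comp]; simp [add_comm]
  have hgdeg : g.natDegree ≤ d := by
    calc g.natDegree ≤ q.natDegree * (C R * X + C ξ).natDegree := natDegree_comp_le
      _ ≤ d * 1 := by
          gcongr
          exact (natDegree_add_le _ _).trans (max_le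
            ((natDegree_C_mul_le _ _).trans natDegree_X_le) (by simp))
      _ = d := mul_one _
  have hgB : ∀ u ∈ Set.Icc (-1 : ℝ) 1, |g.eval u| ≤ c * 6 ^ d := fun u hu => by
    rw [hgev]
    exact abs_eval_le_mul_six_pow_of_forall_nat hq hdL hint (hwin u hu)
  -- damping: `qt = g · (1 - u²)^{7d}`, degree `≤ 15 d`
  set w : ℝ[X] := (1 - X ^ 2) ^ (7 * d) with hw
  have hwev : ∀ u : ℝ, w.eval u = (1 - u ^ 2) ^ (7 * d) := fun u => by simp [hw]
  set qt := g * w with hqt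
  have hqtev : ∀ u : ℝ, qt.eval u = g.eval u * (1 - u ^ 2) ^ (7 * d) := fun u => by
    rw [hqt, eval_mul, hwev]
  have hwdeg : w.natDegree ≤ 14 * d := by
    rw [hw]
    calc ((1 - X ^ 2) ^ (7 * d) : ℝ[X]).natDegree ≤ (7 * d) * (1 - X ^ 2 : ℝ[X]).natDegree :=
          natDegree_pow_le
      _ ≤ (7 * d) * 2 := by
          gcongr
          exact (natDegree_sub_le _ _).trans (max_le (by simp) (by simp))
      _ = 14 * d := by ring
  have hqtdeg : qt.degree ≤ (15 * d : ℕ) := by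
    refine (degree_le_of_natDegree_le ?_)
    calc qt.natDegree ≤ g.natDegree + w.natDegree := natDegree_mul_le
      _ ≤ d + 14 * d := add_le_add hgdeg hwdeg
      _ = 15 * d := by ring
  -- the damping beats the a-priori bound off the centre: `6^d (3/4)^{7d} ≤ 1`
  have hdamp : (6 : ℝ) ^ d * (3 / 4) ^ (7 * d) ≤ 1 := by
    rw [pow_mul, ← mul_pow]
    exact pow_le_one₀ (by norm_num) (by norm_num)
  have hw01 : ∀ u ∈ Set.Icc (-1 : ℝ) 1, 0 ≤ (1 - u ^ 2) ^ (7 * d) ∧ (1 - u ^ 2) ^ (7 * d) ≤ 1 :=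
    fun u hu => by
      have h0 : 0 ≤ 1 - u ^ 2 := by nlinarith [hu.1, hu.2]
      exact ⟨pow_nonneg h0 _, pow_le_one₀ h0 (by nlinarith [hu.1, hu.2])⟩
  have hout : ∀ u ∈ Set.Icc (-1 : ℝ) 1, 1 / 2 ≤ |u| → |qt.eval u| ≤ c := by
    intro u hu hu2
    have hu2' : 1 - u ^ 2 ≤ 3 / 4 := by
      have : (1 / 2 : ℝ) ^ 2 ≤ u ^ 2 := by
        rw [← sq_abs u]; exact pow_le_pow_left₀ (by norm_num) hu2 2
      linarith
    have h0 : 0 ≤ 1 - u ^ 2 := by nlinarith [hu.1, hu.2]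
    rw [hqtev, abs_mul, abs_of_nonneg (pow_nonneg h0 _)]
    calc |g.eval u| * (1 - u ^ 2) ^ (7 * d) ≤ c * 6 ^ d * (3 / 4) ^ (7 * d) :=
          mul_le_mul (hgB u hu) (pow_le_pow_left₀ h0 hu2' _) (pow_nonneg h0 _)
            (by positivity)
      _ = c * (6 ^ d * (3 / 4) ^ (7 * d)) := by ring
      _ ≤ c * 1 := mul_le_mul_of_nonneg_left hdamp hc.le
      _ = c := mul_one c
  -- the maximum `M` of `|qt|` on `[-1, 1]`
  obtain ⟨us, husI, hmax⟩ := (isCompact_Icc (a := (-1 : ℝ)) (b := 1)).exists_isMaxOn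
    (Set.nonempty_Icc.mpr (by norm_num))
    ((qt.differentiable.continuous.abs).continuousOn :
      ContinuousOn (fun u => |qt.eval u|) _)
  set M := |qt.eval us| with hM
  have hMbound : ∀ y ∈ Set.Icc (-1 : ℝ) 1, |qt.eval y| ≤ M := fun y hy => hmax hy
  have hM2 : 2 * c ≤ M := by
    have h0 : |qt.eval 0| ≤ M := hMbound 0 ⟨by norm_num, by norm_num⟩
    rw [hqtev, hgev] at h0
    simpa using hξ.trans (by simpa using h0)
  have hus : |us| < 1 / 2 := by
    by_contra h
    push Not at h
    have := hout us husI h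
    linarith
  -- the nearest grid point `u_i = (i - ξ)/R`, `i` the integer nearest to `ξ + R us`
  set xs := ξ + R * us with hxs
  have hxsI : xs ∈ Set.Icc (0 : ℝ) L := hwin us husI
  set i : ℕ := ⌊xs + 1 / 2⌋₊ with hi
  have hx0 : 0 ≤ xs + 1 / 2 := by linarith [hxsI.1]
  have hi1 : (i : ℝ) ≤ xs + 1 / 2 := Nat.floor_le hx0
  have hi2 : xs + 1 / 2 < i + 1 := Nat.lt_floor_add_one _
  have hiL : i ≤ L := by
    have : i < L + 1 := (Nat.floor_lt hx0).mpr (by push_cast; linarith [hxsI.2])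
    omega
  have hdist : |xs - i| ≤ 1 / 2 := abs_le.mpr ⟨by linarith, by linarith⟩
  set ui := ((i : ℝ) - ξ) / R with hui
  have hui_x : ξ + R * ui = i := by rw [hui]; field_simp; ring
  have hdu : |us - ui| ≤ 1 / (2 * R) := by
    have : us - ui = (xs - i) / R := by rw [hui, hxs]; field_simp; ring
    rw [this, abs_div, abs_of_pos hRpos, div_le_div_iff₀ hRpos (by positivity)]
    nlinarith [hdist]
  have hdu4 : |us - ui| ≤ 1 / 4 := hdu.trans (by
    rw [div_le_div_iff₀ (by positivity) (by norm_num)]; linarith)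
  have hui34 : |ui| ≤ 3 / 4 := by
    have := abs_sub_abs_le_abs_sub ui us
    rw [abs_sub_comm] at this
    linarith [hus.le]
  have huiI : ui ∈ Set.Icc (-1 : ℝ) 1 := by
    rw [Set.mem_Icc, ← abs_le]; linarith
  have hqti : |qt.eval ui| ≤ c := by
    rw [hqtev, hgev, hui_x, abs_mul, abs_of_nonneg (hw01 ui huiI).1]
    calc |q.eval (i : ℝ)| * (1 - ui ^ 2) ^ (7 * d) ≤ c * 1 :=
          mul_le_mul (hint i hiL) (hw01 ui huiI).2 (hw01 ui huiI).1 hc.le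
      _ = c := mul_one c
  have hne : ui ≠ us := by
    rintro h
    rw [h] at hqti
    linarith
  -- mean value theorem between `ui` and `us`: `|qt'(ζ)| ≥ M R` with `|ζ| ≤ 3/4`
  have hvals : M * R * |us - ui| ≤ |qt.eval us - qt.eval ui| := by
    have h1 := abs_sub_abs_le_abs_sub (qt.eval us) (qt.eval ui)
    have hMc : M / 2 ≤ M - c := by linarith
    calc M * R * |us - ui| ≤ M * R * (1 / (2 * R)) :=
          mul_le_mul_of_nonneg_left hdu (by nlinarith)
      _ = M / 2 := by field_simp
      _ ≤ |qt.eval us - qt.eval ui| := hMc.trans (by linarith)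
  have hmvt : ∃ ζ : ℝ, |ζ| ≤ 3 / 4 ∧ M * R ≤ |(derivative qt).eval ζ| := by
    rcases lt_or_gt_of_ne hne with h | h
    · obtain ⟨ζ, hζ, hζd⟩ := exists_abs_derivative_ge h hvals
      refine ⟨ζ, ?_, hζd⟩
      rw [abs_le]
      constructor <;> linarith [hζ.1, hζ.2, (abs_le.mp hui34).1, (abs_le.mp hus.le).2]
    · obtain ⟨ζ, hζ, hζd⟩ := exists_abs_derivative_ge h (K := M * R)
        (by rwa [abs_sub_comm us ui, abs_sub_comm (qt.eval us) (qt.eval ui)] at hvals)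
      refine ⟨ζ, ?_, hζd⟩
      rw [abs_le]
      constructor <;> linarith [hζ.1, hζ.2, (abs_le.mp hui34).2, (abs_le.mp hus.le).1]
  obtain ⟨ζ, hζ34, hζder⟩ := hmvt
  have hζI : ζ ∈ Set.Icc (-1 : ℝ) 1 := by
    rw [Set.mem_Icc, ← abs_le]; linarith
  -- Bernstein's inequality at `ζ`
  have hB := bernstein_inequality hqtdeg hMbound hζI
  have hsqrt : Real.sqrt 7 / 4 ≤ √(1 - ζ ^ 2) := by
    have h1 : (7 : ℝ) / 16 ≤ 1 - ζ ^ 2 := by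
      have : ζ ^ 2 ≤ (3 / 4) ^ 2 := by
        rw [← sq_abs ζ]; exact pow_le_pow_left₀ (abs_nonneg _) hζ34 2
      linarith
    calc Real.sqrt 7 / 4 = √(7 / 16) := by
          rw [show (7 : ℝ) / 16 = 7 / 4 ^ 2 by norm_num, Real.sqrt_div' _ (by norm_num),
            Real.sqrt_sq (by norm_num)]
      _ ≤ √(1 - ζ ^ 2) := Real.sqrt_le_sqrt h1
  have hMpos : 0 < M := by linarith
  -- `M R √7/4 ≤ |qt'(ζ)| √(1-ζ²) ≤ 15 d M`
  have hcast : ((15 * d : ℕ) : ℝ) = 15 * (d : ℝ) := by rw [Nat.cast_mul, Nat.cast_ofNat]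
  have hchain : M * R * (Real.sqrt 7 / 4) ≤ 15 * d * M := by
    calc M * R * (Real.sqrt 7 / 4) ≤ |(derivative qt).eval ζ| * √(1 - ζ ^ 2) :=
          mul_le_mul hζder hsqrt (by positivity) (abs_nonneg _)
      _ ≤ ((15 * d : ℕ) : ℝ) * M := hB
      _ = 15 * d * M := by rw [hcast]
  have h' : M * (R * (Real.sqrt 7 / 4)) ≤ M * (15 * d) := by
    calc M * (R * (Real.sqrt 7 / 4)) = M * R * (Real.sqrt 7 / 4) := by ring
      _ ≤ 15 * d * M := hchain
      _ = M * (15 * d) := by ring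
  have hfin : R * (Real.sqrt 7 / 4) ≤ 15 * d := le_of_mul_le_mul_left h' hMpos
  exact paturi_central_arith hR4 hfin hcon hd'

end Literature.Analysis.Approximation
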